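/-
Origin: expansion seat `planner-pub-hodgecm-prl1-g3-0`, handover #11 2026-08-18T06:29:59Z (`HOME/pub-hodgecm-prl1-g3/lean/Prl1g3/MultiplicityOne.lean`, md5 61a66480, 109 lines);
landed by the gen-7 packager in gate run 25 as `HodgeCM/Automorphic/MultiplicityOne.lean` (import ^import Prl1g3\.→import HodgeCM.Automorphic. ×1).
-/
/-
Copyright: HodgeCMPerL adjudication package. WIP seat prl1-g3 (planner-pub-hodgecm-prl1-g3-0), file 12.
-/
import Summits.HodgeConjecture.HodgeCM.Automorphic.MatrixCoefficients

/-!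
# Multiplicity one, typed: a class has ONE member iff its isotypic component is irreducible

The REDUCE seat's (I5) rests on MULTIPLICITY ONE for the discrete spectrum of `G_U` (Rogawski, Ann. of Math. Stud. 123,
Thm 13.3.3(c), 14.6.2, 14.6.4, 14.6.5 — PRINT).  This file gives the notion a KERNEL definition inside the isotypic
decomposition of file 1 and proves the two readings agree, so that the print fact has ONE typed target and the pairing
consequence is a theorem:

* `MultiplicityOne R c : Prop := Subsingleton (Members R c)` — the class `c` has at most (hence exactly) one member:
  a single irreducible closed invariant subspace of `H` in the unitary-equivalence class `c`;
* `isotypic_eq_of_multiplicityOne` — then `isotypic R c = V` for the (any) member `V`;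
* **`multiplicityOne_iff_isIrreducible : MultiplicityOne R c ↔ IsIrreducible R (isotypic R c)`**;
* `exists_inner_orbit_ne_zero_of_multiplicityOne`, `exists_mem_inner_orbit_ne_zero_of_multiplicityOne_doubleCoset` —
  under multiplicity one any two nonzero vectors of the isotypic component pair under some translate / some
  double-coset representative (file 8);
* `not_multiplicityOne_of_orthogonal_members` — two ORTHOGONAL members of the same class refute multiplicity one
  (e.g. the two copies in `V ⊕ V`), and then nonzero vectors of the two never pair (file 8's negative).

Kernel-checked, no hypotheses beyond those stated; imports file 8 only.
-/

noncomputable section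

open scoped Topology InnerProductSpace

namespace HodgeCM
namespace RepDecomp

open HodgeCM.PerL34 HodgeCM.PerL34.Spectral

variable {H : Type*} [NormedAddCommGroup H] [InnerProductSpace ℂ H]
variable {G : Type*} [Group G] (R : G →* (H →L[ℂ] H))

/-- **Multiplicity one** for the class `c`: it has at most one member (irreducible closed invariant subspace of `H`
in the class).  It always has at least one (`members_nonempty`). -/
def MultiplicityOne (c : IsoClass R) : Prop := Subsingleton (Members R c)

variable {R}

/-- (Ported verbatim from the HodgeCMPerL package; no docstring in the source.) -/
theorem members_nonempty (c : IsoClass R) : Nonempty (Members R c) := by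
  induction c using Quotient.inductionOn with
  | h V => exact ⟨⟨V, rfl⟩⟩

/-- Under multiplicity one the isotypic component IS its member. -/
theorem isotypic_eq_of_multiplicityOne {c : IsoClass R} (h : MultiplicityOne R c) (V : Members R c) :
    isotypic R c = V.1.1 := by
  haveI : Subsingleton (Members R c) := h
  refine le_antisymm (iSup_le fun W => ?_) (le_isotypic V)
  rw [Subsingleton.elim W V]

/-- Under multiplicity one the isotypic component is irreducible. -/
theorem isIrreducible_isotypic_of_multiplicityOne {c : IsoClass R} (h : MultiplicityOne R c) :
    IsIrreducible R (isotypic R c) := by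
  obtain ⟨V⟩ := members_nonempty c
  rw [isotypic_eq_of_multiplicityOne h V]
  exact V.1.2

/-- Conversely, if the isotypic component is irreducible, every member equals it. -/
theorem member_eq_isotypic_of_isIrreducible {c : IsoClass R} (h : IsIrreducible R (isotypic R c))
    (V : Members R c) : (V.1.1 : Submodule ℂ H) = isotypic R c := by
  rcases h.irred V.1.1 (le_isotypic V) V.1.2.isClosed V.1.2.invariant with h0 | h1
  · exact absurd h0 V.1.2.ne_bot
  · exact h1

/-- **Multiplicity one ⟺ the isotypic component is irreducible.** -/
theorem multiplicityOne_iff_isIrreducible (c : IsoClass R) :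
    MultiplicityOne R c ↔ IsIrreducible R (isotypic R c) := by
  refine ⟨isIrreducible_isotypic_of_multiplicityOne, fun h => ⟨fun V W => ?_⟩⟩
  apply Subtype.ext
  apply Subtype.ext
  rw [member_eq_isotypic_of_isIrreducible h V, member_eq_isotypic_of_isIrreducible h W]

/-! ## Consequences for the pairing (file 8) -/

/-- Under multiplicity one, any two nonzero vectors of the isotypic component pair under some translate. -/
theorem exists_inner_orbit_ne_zero_of_multiplicityOne {c : IsoClass R} (h : MultiplicityOne R c) {u u' : H}
    (hu : u ∈ isotypic R c) (hu0 : u ≠ 0) (hu' : u' ∈ isotypic R c) (hu'0 : u' ≠ 0) :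
    ∃ g : G, ⟪R g u, u'⟫_ℂ ≠ 0 :=
  exists_inner_orbit_ne_zero (isIrreducible_isotypic_of_multiplicityOne h) hu hu0 hu' hu'0

/-- Under multiplicity one and `G = Stab(u′) · Λ · Stab(u)` (unitary `R`), some `γ ∈ Λ` pairs. -/
theorem exists_mem_inner_orbit_ne_zero_of_multiplicityOne_doubleCoset (hR : IsUnitaryRep R) {c : IsoClass R}
    (h : MultiplicityOne R c) {Λ : Set G} {u u' : H}
    (hcov : ∀ g : G, ∃ k' : G, ∃ γ ∈ Λ, ∃ k : G, R k u = u ∧ R k' u' = u' ∧ g = k' * γ * k)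
    (hu : u ∈ isotypic R c) (hu0 : u ≠ 0) (hu' : u' ∈ isotypic R c) (hu'0 : u' ≠ 0) :
    ∃ γ ∈ Λ, ⟪R γ u, u'⟫_ℂ ≠ 0 :=
  exists_mem_inner_orbit_ne_zero_of_doubleCoset hR hcov (isIrreducible_isotypic_of_multiplicityOne h) hu hu0 hu' hu'0

/-- **Two orthogonal members refute multiplicity one** — and then their nonzero vectors never pair
(`not_pairing_of_orthogonal_members`, file 8). -/
theorem not_multiplicityOne_of_orthogonal_members {c : IsoClass R} (V W : Members R c)
    (hVW : (W.1.1 : Submodule ℂ H) ≤ (V.1.1 : Submodule ℂ H)ᗮ) : ¬ MultiplicityOne R c := by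
  intro h
  haveI : Subsingleton (Members R c) := h
  have hWV : W = V := Subsingleton.elim W V
  rw [hWV] at hVW
  apply V.1.2.ne_bot
  rw [eq_bot_iff]
  intro v hv
  have : v ∈ (V.1.1 : Submodule ℂ H) ⊓ (V.1.1 : Submodule ℂ H)ᗮ := ⟨hv, hVW hv⟩
  rwa [Submodule.inf_orthogonal_eq_bot] at this

end RepDecomp
end HodgeCM
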